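import Literature.Computability.AlgebraicComplexity.RealTauConjectureAssembly
import Literature.Computability.AlgebraicComplexity.DefinableVNP
import Literature.Computability.AlgebraicComplexity.ValiantCompleteness
import HarnessLib

/-!
# The Koiran–Tavenas transfer theorem from Bürgisser's Cor. 3.9, Lemma 2.12 and the `VNP`-completeness of `PER`

Final assembly for the named fact
`Literature.Computability.AlgebraicComplexity.not_isPBounded_constantFreeComplexity_perPoly_of_realTauConjecture`
(`TauConjecture.lean`; Tavenas 2014, Thm. 3.3): with Tavenas' Prop. 3.17 now derived from the
`VNP`-completeness of the permanent over `ℚ` (`Tavenas2014_prop_3_17_of_isVNPComplete_perPoly`,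
`DefinableVNP.lean`), the three-fact assembly of `RealTauConjectureAssembly.lean` becomes: the
real τ-conjecture implies that `τ(PER_n)` is not polynomially bounded, GIVEN

* Bürgisser's Cor. 3.9 (`Burgisser2009_esymm_chDefinable`: the elementary symmetric functions of
  `1, …, n` are definable in the counting hierarchy — iterated products in `CH` via
  Dlogtime-uniform `TC⁰` division),
* Bürgisser's Lemma 2.12 (`PP_subset_PPoly_of_isPBounded_perPoly`: `τ(PER) = n^{O(1)} ⇒ PP ⊆ P/poly`
  — the `#P`-completeness of the permanent), and
* the `VNP`-completeness of the permanent over `ℚ` (`Literature.PNP.isVNPComplete_perPoly ℚ`,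
  Valiant 1979; Bürgisser 2000, Thm. 2.10),

everything else of the printed proofs (Tavenas Ch. 3 §1; Bürgisser §2; Arora–Barak Thm. 6.18;
Valiant's criterion; the depth-four reduction) being proved in the tree.

Since the third of these is now a theorem of the tree (`isVNPComplete_perPoly_holds`,
`ValiantCompleteness.lean`: Valiant's theorem assembled from BCS 1997, Prop. (21.15),
Thm. (21.26), Thm. (21.27) and Thm. (21.29)), the two named facts of Tavenas' Ch. 3 §1.3 that
rest on it alone are DISCHARGED here: Prop. 3.17 (`Tavenas2014_prop_3_17_holds`) and Prop. 3.21
(`Tavenas2014_prop_3_21_holds`, the target of `RealTauConjectureDepthFour.lean`).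

## References

* S. Tavenas, *Bornes inférieures et supérieures dans les circuits arithmétiques*, PhD thesis,
  ENS Lyon 2014, Thm. 3.3, Lemma 3.9, Prop. 3.10, Lemma 3.16, Prop. 3.17, Prop. 3.21.
* P. Bürgisser, *On defining integers and proving arithmetic circuit lower bounds*, Comput.
  Complexity 18 (2009) 81–103, Lemma 2.5, Lemma 2.12, Cor. 3.9.
* L. G. Valiant, *Completeness classes in algebra*, STOC 1979.
-/

namespace Literature.Computability.AlgebraicComplexity

/-- **Tavenas' Proposition 3.21 from the `VNP`-completeness of the permanent over `ℚ`**
(Prop. 3.17 from completeness, `DefinableVNP.lean`; Prop. 3.21 from Prop. 3.17 and the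
depth-four reduction, `RealTauConjectureDepthFour.lean`). [cite: Tavenas2014, Prop. 3.21] -/
theorem Tavenas2014_prop_3_21_of_isVNPComplete_perPoly (hV : Literature.Computability.AlgebraicComplexity.isVNPComplete_perPoly ℚ) :
    Tavenas2014_prop_3_21 :=
  Tavenas2014_prop_3_21_of_prop_3_17 (Tavenas2014_prop_3_17_of_isVNPComplete_perPoly hV)

/-- **Tavenas' Theorem 3.3 from Bürgisser's Cor. 3.9, Bürgisser's Lemma 2.12 and the
`VNP`-completeness of the permanent over `ℚ`.** [cite: Tavenas2014, Thm. 3.3] -/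
theorem not_isPBounded_constantFreeComplexity_perPoly_of_realTauConjecture_of_facts'
    (h39 : Burgisser2009_esymm_chDefinable) (hV : Literature.Computability.AlgebraicComplexity.isVNPComplete_perPoly ℚ)
    (h212 : PP_subset_PPoly_of_isPBounded_perPoly) :
    not_isPBounded_constantFreeComplexity_perPoly_of_realTauConjecture :=
  not_isPBounded_constantFreeComplexity_perPoly_of_realTauConjecture_of_facts h39
    (Tavenas2014_prop_3_17_of_isVNPComplete_perPoly hV) h212

/-! ### Discharges: Prop. 3.17 and Prop. 3.21 are theorems -/

/-- **Discharge of Tavenas' Proposition 3.17** (thesis 2014, Prop. 3.17, p. 45, case of one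
variable over `K = ℚ`, in the rendering `Tavenas2014_prop_3_17` of
`RealTauConjectureDepthFour.lean`): the printed proof — Valiant's criterion applied to the
`P/poly` bit language of the coefficients, then the `VNP`-completeness of the permanent
(`Tavenas2014_prop_3_17_of_isVNPComplete_perPoly`, `DefinableVNP.lean`) — fed with Valiant's
theorem over `ℚ` (`isVNPComplete_perPoly_holds ℚ`, `ValiantCompleteness.lean`). [cite: Tavenas2014, Prop. 3.17] -/
theorem Tavenas2014_prop_3_17_holds : Tavenas2014_prop_3_17 :=
  Tavenas2014_prop_3_17_of_isVNPComplete_perPoly (isVNPComplete_perPoly_holds ℚ)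

/-- **Discharge of Tavenas' Proposition 3.21** (thesis 2014, Prop. 3.21, p. 46, case `c = 1`
over `K = ℚ`, the named fact `Tavenas2014_prop_3_21` of `RealTauConjectureProofs.lean`): if
`τ(PER_n) = n^{O(1)}` then every family `(f_n) ⊂ ℤ[X]` definable in `P/poly` with
`deg f_n < 2^d`, coefficients `< 2^{2^r}`, `r ≤ d = n^{O(1)}`, is a sum of `n^{O(√d)}` products
of `O(√d)` many `n^{O(√d)}`-sparse polynomials. Printed proof (p. 47): "D'après la
proposition 3.17 … D'après le théorème 2.16 …" — here `Tavenas2014_prop_3_17_holds` and the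
proved derivation `Tavenas2014_prop_3_21_of_prop_3_17` (`RealTauConjectureDepthFour.lean`: the
depth-four reduction `DepthReduction.SLP.exists_sum_prod` and sparsity under the substitution
(3.1)). [cite: Tavenas2014, Prop. 3.21] -/
theorem Tavenas2014_prop_3_21_holds : Tavenas2014_prop_3_21 :=
  Tavenas2014_prop_3_21_of_prop_3_17 Tavenas2014_prop_3_17_holds

end Literature.Computability.AlgebraicComplexity
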